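import Summits.Ventures.LatticeQCDFlow.Scaling.ReplicaExchangeBareSampler
import Summits.Ventures.LatticeQCDFlow.Scaling.ReplicaExchangeModeTorpid
import Summits.Ventures.LatticeQCDFlow.Scaling.SimulatedTemperingModeTorpid

/-!
HONEST FRAMING: exact (Metropolis-corrected) sampling algorithms for lattice gauge theory; figures
of merit are autocorrelation/cost numbers at stated couplings and volumes; no continuum-physics
claim.

# ReplicaExchangeDiffusive — REPLICA EXCHANGE IS AT BEST DIFFUSIVE IN THE NUMBER OF REPLICAS: PROFILE TEST FUNCTIONS
# `G_a(x) = Σ_k a_k·f_A^{(μ_k)}(x_k)` FOR THE TAGLESS SAMPLER GIVE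
# `Gap ≤ [t/(2K)·Σ_j (a_j − a_{j+1})²·D_j(A) + (1−t)/(K+1)·Σ_k a_k²·Q_k(A,Aᶜ)] / Σ_k a_k²·μ_k(A)μ_k(Aᶜ)`,
# AND THE LINEAR PROFILE, BLIND TO THE HOT REPLICA, GIVES `Gap ≤ 3t·d/(v·K(K+1)(2K+1))` WHEN NO COLD REPLICA
# CROSSES THE SECTOR ON ITS OWN (lean-2 GEN-19, ours)

Venture-side (OURS).  Cell `lqcd-flow` (pub-lqcd), unit `pub-lqcd-lean-2-g19`, 2026-08-25.  Chapter R, file 10.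
Setting of `Scaling/ReplicaExchangeBareSampler` (R1): finite configuration space `S`, positive probability vectors
`μ_k` (`k : Fin (K+1)`), replica updates `M_k` (row-stochastic, `μ_k`-reversible), the TAGLESS sampler
`ptBareSampler t μ M = t·(Metropolis swap of a uniform adjacent pair) + (1−t)·(update of a uniform replica)` with
target `π̃ = ⊗_k μ_k`.  GEN-17's `Scaling/ReplicaExchangeModeTorpid` (Z1) used the centred SECTOR COUNT of a set of
configurations `A`, to which the swap move is invisible; its ceiling says nothing once ONE replica (the hot one)
crosses the sector freely.  Here the count is WEIGHTED BY A PROFILE `a` along the ladder: a swap of levels `j, j+1`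
changes `G_a` by `(a_j − a_{j+1})(1_{Aᶜ}(x_j) − 1_{Aᶜ}(x_{j+1}))` — the swap move pays the SQUARED PROFILE GRADIENT
times the DISAGREEMENT MASS `D_j(A) = μ_j(A)μ_{j+1}(Aᶜ) + μ_j(Aᶜ)μ_{j+1}(A)`; `a_0 = 0` hides the hot replica.

## What is proved

* §1 `sum_sq_fin`; `sum_mul_coindicator`, `sum_tensorFun_mul_coindicator`; **`levelDisagreement_eq`**.
* §2 `ptBare_mean_profileCount`, **`ptBare_piInner_profileCount`** (`‖G_a‖² = Σ_k a_k²μ_k(A)μ_k(Aᶜ)`),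
  **`ptBare_dirichletForm_update_profileCount`** (`𝓔_{Upd}(G_a) = (K+1)⁻¹Σ_k a_k²Q_k(A,Aᶜ)`),
  `profileCount_sub_swap`, **`ptBare_dirichletForm_swap_le`** (ANY observable:
  `𝓔_{Sw}(F) ≤ (2K)⁻¹Σ_jΣ_x π̃(x)(F(x) − F(x∘σ_j))²`), **`ptBare_dirichletForm_swap_profileCount_le`**
  (`𝓔_{Sw}(G_a) ≤ (2K)⁻¹Σ_j (a_j − a_{j+1})²D_j(A)`), `ptBare_dirichletForm_split`.
* §3 **`ptBare_spectralGap_le_profile`** — THE PROFILE CEILING of the title (`0 ≤ t ≤ 1`, `|S| ≥ 2`).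
* §4 (`K ≥ 1`) **`ptBareLinear_spectralGap_le`** — `a_k = k`:
  `Gap ≤ 6·(t·d/2 + (1−t)/(K+1)·Σ_k k²Q_k(A,Aᶜ))/(v·K(K+1)(2K+1))` whenever `D_j(A) ≤ d` and
  `μ_k(A)μ_k(Aᶜ) ≥ v > 0` at every level `k ≥ 1` (the hot update `M_0` does not enter);
  **`ptBareFrozenSector_spectralGap_le`** — if no replica at a level `k ≥ 1` crosses the sector (`Q_k(A,Aᶜ) = 0`),
  `Gap(ptBareSampler t μ M) ≤ 3t·d/(v·K(K+1)(2K+1))`: relaxation `≥ v·K(K+1)(2K+1)/(3td)` steps, CUBIC in the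
  number of replicas, against chapter R's quartic floor (`Scaling/ReplicaExchangeModeGap`, `…FrozenCold`).

Companion `Scaling/ReplicaExchangeDiffusiveTauInt`: `D_j ≤ 1`, the `τ_int` floor, identical levels.  NOT CLAIMED:
the exact order between `K³` and `K⁴`; other swap schedules; general spaces; anything measured.  Literature grade
(cell rule): KNOWN MECHANISM (test-function ceilings; diffusive round trips of replica exchange are folklore), NEW
TYPING (exact profile identities for the tagless sampler); nothing cited as a fact; no new bib keys.
-/

noncomputable section

open Finset Function
open Literature.Probability.MarkovChains

namespace Summit.Ventures.LatticeQCDFlow.Scaling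

/-! ## §1 Elementary tools: the sum of squares, co-indicator masses, the disagreement mass -/

/-- `Σ_{k : Fin (K+1)} k² = K(K+1)(2K+1)/6`. [folklore] -/
theorem sum_sq_fin (K : ℕ) : ∑ k : Fin (K + 1), ((k : ℕ) : ℝ) ^ 2 = (K : ℝ) * (K + 1) * (2 * K + 1) / 6 := by
  induction K with
  | zero => simp
  | succ K ih =>
      rw [Fin.sum_univ_castSucc]
      simp only [Fin.val_castSucc, Fin.val_last]
      rw [ih]; push_cast; ring

variable {S : Type*} [Fintype S] [DecidableEq S] {K : ℕ}

section Product

variable (μ : Fin (K + 1) → S → ℝ)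

/-- The co-indicator mass of a vector: `Σ_u ν(u)·1_{Aᶜ}(u) = ν(Aᶜ)`. [folklore] -/
theorem sum_mul_coindicator (ν : S → ℝ) (A : Finset S) :
    ∑ u, ν u * (if u ∈ A then (0 : ℝ) else 1) = ∑ u ∈ Aᶜ, ν u := by
  rw [← Finset.sum_add_sum_compl A]
  have h0 : ∑ u ∈ A, ν u * (if u ∈ A then (0 : ℝ) else 1) = 0 :=
    Finset.sum_eq_zero fun u hu => by rw [if_pos hu, mul_zero]
  rw [h0, zero_add]
  exact sum_congr rfl fun u hu => by rw [if_neg (Finset.mem_compl.mp hu), mul_one]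

/-- The one-level co-indicator mass under the product law: `Σ_x π̃(x)·1_{Aᶜ}(x_i) = μ_i(Aᶜ)`. [folklore] -/
theorem sum_tensorFun_mul_coindicator (hμ1 : ∀ k, ∑ u, μ k u = 1) (A : Finset S) (i : Fin (K + 1)) :
    ∑ x : Fin (K + 1) → S, tensorFun μ x * (if x i ∈ A then (0 : ℝ) else 1) = ∑ u ∈ Aᶜ, μ i u := by
  rw [sum_tensorFun_mul_apply μ hμ1 i (fun u => if u ∈ A then (0 : ℝ) else 1)]
  exact sum_mul_coindicator (μ i) A

/-- **The disagreement mass of two levels on a set:** for `i ≠ l`,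
`Σ_x π̃(x)·(1_{Aᶜ}(x_i) − 1_{Aᶜ}(x_l))² = μ_i(A)μ_l(Aᶜ) + μ_i(Aᶜ)μ_l(A)`. [folklore] -/
theorem levelDisagreement_eq (hμ1 : ∀ k, ∑ u, μ k u = 1) (A : Finset S) {i l : Fin (K + 1)} (hil : i ≠ l) :
    ∑ x : Fin (K + 1) → S, tensorFun μ x
        * ((if x i ∈ A then (0 : ℝ) else 1) - (if x l ∈ A then (0 : ℝ) else 1)) ^ 2
      = (∑ u ∈ A, μ i u) * (∑ u ∈ Aᶜ, μ l u) + (∑ u ∈ Aᶜ, μ i u) * ∑ u ∈ A, μ l u := by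
  have hsq : ∀ x : Fin (K + 1) → S,
      tensorFun μ x * ((if x i ∈ A then (0 : ℝ) else 1) - (if x l ∈ A then (0 : ℝ) else 1)) ^ 2
        = tensorFun μ x * (if x i ∈ A then (0 : ℝ) else 1) + tensorFun μ x * (if x l ∈ A then (0 : ℝ) else 1)
          - 2 * (tensorFun μ x * ((if x i ∈ A then (0 : ℝ) else 1) * (if x l ∈ A then (0 : ℝ) else 1))) := by
    intro x
    split_ifs <;> ring
  simp_rw [hsq]
  rw [Finset.sum_sub_distrib, Finset.sum_add_distrib, ← Finset.mul_sum,
    sum_tensorFun_mul_coindicator μ hμ1 A i, sum_tensorFun_mul_coindicator μ hμ1 A l,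
    sum_tensorFun_mul_two μ hμ1 hil (fun u => if u ∈ A then (0 : ℝ) else 1) (fun u => if u ∈ A then (0 : ℝ) else 1),
    sum_mul_coindicator (μ i) A, sum_mul_coindicator (μ l) A]
  have hci' : ∑ u ∈ A, μ i u = 1 - ∑ u ∈ Aᶜ, μ i u := by rw [← hμ1 i, ← Finset.sum_add_sum_compl A (μ i)]; ring
  have hcl' : ∑ u ∈ A, μ l u = 1 - ∑ u ∈ Aᶜ, μ l u := by rw [← hμ1 l, ← Finset.sum_add_sum_compl A (μ l)]; ring
  rw [hci', hcl']
  ring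

end Product

/-! ## §2 The profile count `G_a(x) = Σ_k a_k·f_A^{(μ_k)}(x_k)`: mean, norm, the two Dirichlet forms -/

section Profile

variable {μ : Fin (K + 1) → S → ℝ} {M : Fin (K + 1) → S → S → ℝ} {t : ℝ}

/-- **The profile count is centred:** `Σ_x π̃(x)·G_a(x) = 0`. [ours] -/
theorem ptBare_mean_profileCount (hμ1 : ∀ k, ∑ u, μ k u = 1) (a : Fin (K + 1) → ℝ) (A : Finset S) :
    ∑ x : Fin (K + 1) → S, tensorFun μ x * ∑ k, a k * bottleneckTestFun (μ k) A (x k) = 0 := by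
  rw [sum_tensorFun_mul_additive μ hμ1 (fun k u => a k * bottleneckTestFun (μ k) A u)]
  refine Finset.sum_eq_zero fun k _ => ?_
  have e : ∑ u, μ k u * (a k * bottleneckTestFun (μ k) A u) = a k * ∑ u, μ k u * bottleneckTestFun (μ k) A u := by
    rw [Finset.mul_sum]; exact sum_congr rfl fun u _ => by ring
  rw [e, sum_mul_bottleneckTestFun, mul_zero]

/-- **The square norm of the profile count: `‖G_a‖²_π̃ = Σ_k a_k²·μ_k(A)μ_k(Aᶜ)`.** [ours] -/
theorem ptBare_piInner_profileCount (hμ1 : ∀ k, ∑ u, μ k u = 1) (a : Fin (K + 1) → ℝ) (A : Finset S) :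
    piInner (tensorFun μ) (fun x => ∑ k, a k * bottleneckTestFun (μ k) A (x k))
        (fun x => ∑ k, a k * bottleneckTestFun (μ k) A (x k))
      = ∑ k, a k ^ 2 * ((∑ u ∈ A, μ k u) * ∑ u ∈ Aᶜ, μ k u) := by
  have h := piInner_tensorFun_additive μ hμ1 (fun k u => a k * bottleneckTestFun (μ k) A u) (fun k => by
    have e : ∑ u, μ k u * (a k * bottleneckTestFun (μ k) A u) = a k * ∑ u, μ k u * bottleneckTestFun (μ k) A u := by
      rw [Finset.mul_sum]; exact sum_congr rfl fun u _ => by ring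
    rw [e, sum_mul_bottleneckTestFun, mul_zero])
  rw [h]
  refine sum_congr rfl fun k _ => ?_
  rw [← piInner_bottleneckTestFun (hμ1 k) A]
  unfold piInner
  rw [Finset.mul_sum]
  exact sum_congr rfl fun u _ => by ring

/-- **The replica update's Dirichlet form of the profile count:**
`𝓔_π̃(prodKernel (K+1)⁻¹ M; G_a) = (K+1)⁻¹·Σ_k a_k²·Q_k(A,Aᶜ)` — one replica moves at a time. [ours] -/
theorem ptBare_dirichletForm_update_profileCount (hμ1 : ∀ k, ∑ u, μ k u = 1) (hM : ∀ k, IsRowStochastic (M k))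
    (hMrev : ∀ k, DetailedBalance (μ k) (M k)) (a : Fin (K + 1) → ℝ) (A : Finset S) :
    dirichletForm (tensorFun μ) (prodKernel (fun _ : Fin (K + 1) => (1 : ℝ) / (K + 1)) M)
        (fun x => ∑ k, a k * bottleneckTestFun (μ k) A (x k))
      = 1 / (K + 1) * ∑ k, a k ^ 2 * edgeMeasure (μ k) (M k) A Aᶜ := by
  rw [dirichletForm_prodKernel_additive μ hμ1 (fun _ : Fin (K + 1) => (1 : ℝ) / (K + 1)) M
    (fun k u => a k * bottleneckTestFun (μ k) A u), Finset.mul_sum]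
  refine sum_congr rfl fun k _ => ?_
  rw [dirichletForm_smul, dirichletForm_bottleneckTestFun (hM k) ((hMrev k).isStationary (hM k).2) (hμ1 k) A]

/-- **The swap difference formula:** exchanging levels `j, j+1` changes the profile count by
`(a_j − a_{j+1})·(1_{Aᶜ}(x_j) − 1_{Aᶜ}(x_{j+1}))` (the centring constants cancel levelwise). [ours] -/
theorem profileCount_sub_swap (hμ1 : ∀ k, ∑ u, μ k u = 1) (a : Fin (K + 1) → ℝ) (A : Finset S)
    (x : Fin (K + 1) → S) (j : Fin K) :
    (∑ k, a k * bottleneckTestFun (μ k) A (x k)) - ∑ k, a k * bottleneckTestFun (μ k) A (x (levelSwap j k))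
      = (a j.castSucc - a j.succ)
          * ((if x j.castSucc ∈ A then (0 : ℝ) else 1) - (if x j.succ ∈ A then (0 : ℝ) else 1)) := by
  have hne : j.castSucc ≠ j.succ := ne_of_lt Fin.castSucc_lt_succ
  simp_rw [bottleneckTestFun_eq (hμ1 _)]
  rw [← Finset.sum_sub_distrib]
  have hterm : ∀ k, a k * ((if x k ∈ A then (0 : ℝ) else 1) - ∑ y ∈ Aᶜ, μ k y)
      - a k * ((if x (levelSwap j k) ∈ A then (0 : ℝ) else 1) - ∑ y ∈ Aᶜ, μ k y)
      = a k * ((if x k ∈ A then (0 : ℝ) else 1) - (if x (levelSwap j k) ∈ A then (0 : ℝ) else 1)) := by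
    intro k; ring
  simp_rw [hterm]
  rw [Fintype.sum_eq_add j.castSucc j.succ hne]
  · unfold levelSwap
    rw [Equiv.swap_apply_left, Equiv.swap_apply_right]
    ring
  · intro k hk
    unfold levelSwap
    rw [Equiv.swap_apply_of_ne_of_ne hk.1 hk.2, sub_self, mul_zero]

/-- **The swap move's Dirichlet form of ANY observable:** `𝓔_π̃(ptBareSwap μ; F) ≤ (2K)⁻¹·Σ_j Σ_x π̃(x)(F(x) −
F(x∘σ_j))²` — the Metropolis acceptance is at most one and each adjacent pair is proposed with probability `1/K`.
[ours] -/
theorem ptBare_dirichletForm_swap_le (hμ : ∀ k x, 0 < μ k x) (F : (Fin (K + 1) → S) → ℝ) :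
    dirichletForm (tensorFun μ) (ptBareSwap μ) F
      ≤ 1 / (2 * K) * ∑ j : Fin K, ∑ x : Fin (K + 1) → S, tensorFun μ x * (F x - F (x ∘ levelSwap j)) ^ 2 := by
  have hpt : ∀ x y : Fin (K + 1) → S,
      tensorFun μ x * ptBareSwap μ x y * (F x - F y) ^ 2 ≤ ptBareProposal x y * (tensorFun μ x * (F x - F y) ^ 2) := by
    intro x y
    by_cases hyx : y = x
    · rw [hyx, sub_self]; simp
    · rw [← mul_assoc]
      refine mul_le_mul_of_nonneg_right ?_ (sq_nonneg _)
      rw [tensorFun_mul_ptBareSwap hμ hyx]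
      exact mul_le_mul_of_nonneg_left (min_le_left _ _) (ptBareProposal_nonneg x y)
  have hrow : ∀ (x : Fin (K + 1) → S) (c : (Fin (K + 1) → S) → ℝ),
      ∑ y, ptBareProposal x y * c y = ∑ j : Fin K, 1 / K * c (x ∘ levelSwap j) := by
    intro x c
    unfold ptBareProposal
    simp_rw [Finset.sum_mul]
    rw [Finset.sum_comm]
    refine sum_congr rfl fun j _ => ?_
    simp_rw [ite_mul, zero_mul]
    rw [Finset.sum_ite_eq' univ (x ∘ levelSwap j), if_pos (mem_univ _)]
  unfold dirichletForm
  calc 1 / 2 * ∑ x, ∑ y, tensorFun μ x * ptBareSwap μ x y * (F x - F y) ^ 2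
      ≤ 1 / 2 * ∑ x, ∑ y, ptBareProposal x y * (tensorFun μ x * (F x - F y) ^ 2) :=
        mul_le_mul_of_nonneg_left (sum_le_sum fun x _ => sum_le_sum fun y _ => hpt x y) (by norm_num)
    _ = 1 / 2 * ∑ x, ∑ j : Fin K, 1 / K * (tensorFun μ x * (F x - F (x ∘ levelSwap j)) ^ 2) := by
        congr 1
        exact sum_congr rfl fun x _ => hrow x (fun y => tensorFun μ x * (F x - F y) ^ 2)
    _ = 1 / (2 * K) * ∑ j : Fin K, ∑ x : Fin (K + 1) → S, tensorFun μ x * (F x - F (x ∘ levelSwap j)) ^ 2 := by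
        rw [Finset.sum_comm]
        simp_rw [← Finset.mul_sum]
        rw [← mul_assoc]
        congr 1
        ring

/-- **The swap move's Dirichlet form of the profile count:**
`𝓔_π̃(ptBareSwap μ; G_a) ≤ (2K)⁻¹·Σ_j (a_j − a_{j+1})²·D_j(A)`. [ours] -/
theorem ptBare_dirichletForm_swap_profileCount_le (hμ : ∀ k x, 0 < μ k x) (hμ1 : ∀ k, ∑ u, μ k u = 1)
    (a : Fin (K + 1) → ℝ) (A : Finset S) :
    dirichletForm (tensorFun μ) (ptBareSwap μ) (fun x => ∑ k, a k * bottleneckTestFun (μ k) A (x k))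
      ≤ 1 / (2 * K) * ∑ j : Fin K, (a j.castSucc - a j.succ) ^ 2
          * ((∑ u ∈ A, μ j.castSucc u) * (∑ u ∈ Aᶜ, μ j.succ u)
            + (∑ u ∈ Aᶜ, μ j.castSucc u) * ∑ u ∈ A, μ j.succ u) := by
  refine le_trans (ptBare_dirichletForm_swap_le hμ _) (le_of_eq ?_)
  congr 1
  refine sum_congr rfl fun j _ => ?_
  rw [← levelDisagreement_eq μ hμ1 A (i := j.castSucc) (l := j.succ) (ne_of_lt Fin.castSucc_lt_succ),
    Finset.mul_sum]
  refine sum_congr rfl fun x _ => ?_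
  simp only [Function.comp_apply]
  rw [profileCount_sub_swap hμ1 a A x j]
  ring

/-- The sampler's Dirichlet form splits: `𝓔_P(G) = t·𝓔_{Sw}(G) + (1−t)·𝓔_{Upd}(G)` (any observable). [ours] -/
theorem ptBare_dirichletForm_split (t : ℝ) (μ : Fin (K + 1) → S → ℝ) (M : Fin (K + 1) → S → S → ℝ)
    (G : (Fin (K + 1) → S) → ℝ) :
    dirichletForm (tensorFun μ) (ptBareSampler t μ M) G
      = t * dirichletForm (tensorFun μ) (ptBareSwap μ) G
        + (1 - t) * dirichletForm (tensorFun μ) (prodKernel (fun _ : Fin (K + 1) => (1 : ℝ) / (K + 1)) M) G := by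
  unfold dirichletForm
  rw [← mul_assoc, ← mul_assoc, mul_comm t, mul_comm (1 - t), mul_assoc, mul_assoc, ← mul_add]
  congr 1
  rw [Finset.mul_sum, Finset.mul_sum, ← Finset.sum_add_distrib]
  refine sum_congr rfl fun x _ => ?_
  rw [Finset.mul_sum, Finset.mul_sum, ← Finset.sum_add_distrib]
  refine sum_congr rfl fun y _ => ?_
  rw [ptBareSampler_apply]
  ring

/-! ## §3 The profile ceiling -/

/-- **THE PROFILE CEILING FOR THE TAGLESS REPLICA-EXCHANGE SAMPLER:** for every profile `a` along the ladder and
every set of configurations `A` with `Σ_k a_k²μ_k(A)μ_k(Aᶜ) > 0`,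
`Gap(ptBareSampler t μ M) ≤ [t·(2K)⁻¹·Σ_j (a_j − a_{j+1})²·D_j(A) + (1−t)·(K+1)⁻¹·Σ_k a_k²·Q_k(A,Aᶜ)]
/ Σ_k a_k²·μ_k(A)μ_k(Aᶜ)` — the swap move pays the squared profile gradient times the disagreement mass, the
updates pay the profile-weighted sector exit flows. [ours] -/
theorem ptBare_spectralGap_le_profile [Nontrivial S] (hμ : ∀ k x, 0 < μ k x) (hμ1 : ∀ k, ∑ u, μ k u = 1)
    (hM : ∀ k, IsRowStochastic (M k)) (hMrev : ∀ k, DetailedBalance (μ k) (M k)) (ht0 : 0 ≤ t) (ht1 : t ≤ 1)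
    (a : Fin (K + 1) → ℝ) (A : Finset S) (hA : 0 < ∑ k, a k ^ 2 * ((∑ u ∈ A, μ k u) * ∑ u ∈ Aᶜ, μ k u)) :
    spectralGap (tensorFun μ) (ptBareSampler t μ M)
      ≤ (t * (1 / (2 * K) * ∑ j : Fin K, (a j.castSucc - a j.succ) ^ 2
            * ((∑ u ∈ A, μ j.castSucc u) * (∑ u ∈ Aᶜ, μ j.succ u)
              + (∑ u ∈ Aᶜ, μ j.castSucc u) * ∑ u ∈ A, μ j.succ u))
          + (1 - t) * (1 / (K + 1) * ∑ k, a k ^ 2 * edgeMeasure (μ k) (M k) A Aᶜ))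
        / ∑ k, a k ^ 2 * ((∑ u ∈ A, μ k u) * ∑ u ∈ Aᶜ, μ k u) := by
  have hP := ptBareSampler_isRowStochastic (M := M) hμ hM ht0 ht1
  have hDB := ptBareSampler_detailedBalance (t := t) (M := M) hμ hMrev
  have hray := LevinPeres2017_lemma_13_7_rayleigh (tensorFun_pos hμ) (sum_tensorFun_eq_one μ hμ1) hP hDB
    (ptBare_mean_profileCount (μ := μ) hμ1 a A)
  rw [ptBare_piInner_profileCount hμ1 a A, ptBare_dirichletForm_split,
    ptBare_dirichletForm_update_profileCount hμ1 hM hMrev a A] at hray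
  have hsw := ptBare_dirichletForm_swap_profileCount_le (μ := μ) hμ hμ1 a A
  rw [le_div_iff₀ hA]
  calc spectralGap (tensorFun μ) (ptBareSampler t μ M) * ∑ k, a k ^ 2 * ((∑ u ∈ A, μ k u) * ∑ u ∈ Aᶜ, μ k u)
      ≤ t * dirichletForm (tensorFun μ) (ptBareSwap μ) (fun x => ∑ k, a k * bottleneckTestFun (μ k) A (x k))
          + (1 - t) * (1 / (K + 1) * ∑ k, a k ^ 2 * edgeMeasure (μ k) (M k) A Aᶜ) := hray
    _ ≤ t * (1 / (2 * K) * ∑ j : Fin K, (a j.castSucc - a j.succ) ^ 2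
            * ((∑ u ∈ A, μ j.castSucc u) * (∑ u ∈ Aᶜ, μ j.succ u)
              + (∑ u ∈ Aᶜ, μ j.castSucc u) * ∑ u ∈ A, μ j.succ u))
          + (1 - t) * (1 / (K + 1) * ∑ k, a k ^ 2 * edgeMeasure (μ k) (M k) A Aᶜ) := by
        have := mul_le_mul_of_nonneg_left hsw ht0
        linarith

/-! ## §4 The linear profile: the diffusive ceiling -/

/-- With the linear profile `a_k = k` the swap term is `(2K)⁻¹·Σ_j D_j(A) ≤ d/2` when `D_j(A) ≤ d` (`K ≥ 1`).
[ours] -/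
theorem linearProfile_swap_le (hK : 1 ≤ K) {μ : Fin (K + 1) → S → ℝ} (A : Finset S) {d : ℝ}
    (hd : ∀ j : Fin K, (∑ u ∈ A, μ j.castSucc u) * (∑ u ∈ Aᶜ, μ j.succ u)
      + (∑ u ∈ Aᶜ, μ j.castSucc u) * ∑ u ∈ A, μ j.succ u ≤ d) :
    1 / (2 * K) * ∑ j : Fin K, (((j.castSucc : ℕ) : ℝ) - ((j.succ : ℕ) : ℝ)) ^ 2
        * ((∑ u ∈ A, μ j.castSucc u) * (∑ u ∈ Aᶜ, μ j.succ u)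
          + (∑ u ∈ Aᶜ, μ j.castSucc u) * ∑ u ∈ A, μ j.succ u) ≤ d / 2 := by
  have hone : ∀ j : Fin K, (((j.castSucc : ℕ) : ℝ) - ((j.succ : ℕ) : ℝ)) ^ 2 = 1 := by
    intro j; simp only [Fin.val_castSucc, Fin.val_succ]; push_cast; ring
  simp_rw [hone, one_mul]
  have hsum : ∑ j : Fin K, ((∑ u ∈ A, μ j.castSucc u) * (∑ u ∈ Aᶜ, μ j.succ u)
      + (∑ u ∈ Aᶜ, μ j.castSucc u) * ∑ u ∈ A, μ j.succ u) ≤ K * d :=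
    (sum_le_sum fun j _ => hd j).trans
      (by rw [Finset.sum_const, Finset.card_univ, Fintype.card_fin, nsmul_eq_mul])
  have hKpos : (0 : ℝ) < K := Nat.cast_pos.mpr (by omega)
  calc 1 / (2 * K) * ∑ j : Fin K, ((∑ u ∈ A, μ j.castSucc u) * (∑ u ∈ Aᶜ, μ j.succ u)
          + (∑ u ∈ Aᶜ, μ j.castSucc u) * ∑ u ∈ A, μ j.succ u)
      ≤ 1 / (2 * K) * (K * d) := mul_le_mul_of_nonneg_left hsum (by positivity)
    _ = d / 2 := by
        rw [div_mul_eq_mul_div, one_mul, div_eq_div_iff (by positivity) (by norm_num)]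
        ring

/-- With the linear profile the square norm is `Σ_k k²·μ_k(A)μ_k(Aᶜ) ≥ v·K(K+1)(2K+1)/6` when every level `k ≥ 1`
has `μ_k(A)μ_k(Aᶜ) ≥ v` (the hot level carries weight `0`). [ours] -/
theorem linearProfile_norm_ge {μ : Fin (K + 1) → S → ℝ} (A : Finset S) {v : ℝ}
    (hv : ∀ k : Fin (K + 1), k ≠ 0 → v ≤ (∑ u ∈ A, μ k u) * ∑ u ∈ Aᶜ, μ k u) :
    v * ((K : ℝ) * (K + 1) * (2 * K + 1) / 6)
      ≤ ∑ k : Fin (K + 1), ((k : ℕ) : ℝ) ^ 2 * ((∑ u ∈ A, μ k u) * ∑ u ∈ Aᶜ, μ k u) := by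
  rw [← sum_sq_fin K, Finset.mul_sum]
  refine sum_le_sum fun k _ => ?_
  by_cases hk : k = 0
  · subst hk; simp
  · rw [mul_comm]
    exact mul_le_mul_of_nonneg_left (hv k hk) (sq_nonneg _)

/-- **THE LINEAR-PROFILE CEILING (the hot replica does not enter):** if `D_j(A) ≤ d` for every adjacent pair and
`μ_k(A)μ_k(Aᶜ) ≥ v > 0` at every level `k ≥ 1` (`K ≥ 1`, `0 ≤ t ≤ 1`, `|S| ≥ 2`), then whatever `M_0` is,
`Gap(ptBareSampler t μ M) ≤ 6·(t·d/2 + (1−t)·(K+1)⁻¹·Σ_k k²·Q_k(A,Aᶜ))/(v·K(K+1)(2K+1))`. [ours] -/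
theorem ptBareLinear_spectralGap_le [Nontrivial S] (hK : 1 ≤ K) (hμ : ∀ k x, 0 < μ k x)
    (hμ1 : ∀ k, ∑ u, μ k u = 1) (hM : ∀ k, IsRowStochastic (M k)) (hMrev : ∀ k, DetailedBalance (μ k) (M k))
    (ht0 : 0 ≤ t) (ht1 : t ≤ 1) (A : Finset S) {d v : ℝ} (hvpos : 0 < v)
    (hd : ∀ j : Fin K, (∑ u ∈ A, μ j.castSucc u) * (∑ u ∈ Aᶜ, μ j.succ u)
      + (∑ u ∈ Aᶜ, μ j.castSucc u) * ∑ u ∈ A, μ j.succ u ≤ d)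
    (hv : ∀ k : Fin (K + 1), k ≠ 0 → v ≤ (∑ u ∈ A, μ k u) * ∑ u ∈ Aᶜ, μ k u) :
    spectralGap (tensorFun μ) (ptBareSampler t μ M)
      ≤ 6 * (t * (d / 2) + (1 - t) * (1 / (K + 1) * ∑ k : Fin (K + 1), ((k : ℕ) : ℝ) ^ 2
          * edgeMeasure (μ k) (M k) A Aᶜ)) / (v * ((K : ℝ) * (K + 1) * (2 * K + 1))) := by
  have hKpos : (0 : ℝ) < K := Nat.cast_pos.mpr (by omega)
  have hnorm := linearProfile_norm_ge (μ := μ) A hv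
  have hS : 0 < v * ((K : ℝ) * (K + 1) * (2 * K + 1) / 6) := by positivity
  have hA : 0 < ∑ k : Fin (K + 1), ((k : ℕ) : ℝ) ^ 2 * ((∑ u ∈ A, μ k u) * ∑ u ∈ Aᶜ, μ k u) :=
    lt_of_lt_of_le hS hnorm
  have hmain := ptBare_spectralGap_le_profile (t := t) (M := M) hμ hμ1 hM hMrev ht0 ht1
    (fun k : Fin (K + 1) => ((k : ℕ) : ℝ)) A hA
  have hswap := linearProfile_swap_le (μ := μ) hK A hd
  have hQ : 0 ≤ (1 - t) * (1 / (K + 1) * ∑ k : Fin (K + 1), ((k : ℕ) : ℝ) ^ 2 * edgeMeasure (μ k) (M k) A Aᶜ) :=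
    mul_nonneg (by linarith) (mul_nonneg (by positivity) (sum_nonneg fun k _ => mul_nonneg (sq_nonneg _)
      (sum_nonneg fun x _ => sum_nonneg fun y _ => mul_nonneg (hμ k x).le ((hM k).1 x y))))
  have hd0 : 0 ≤ d := le_trans (add_nonneg
    (mul_nonneg (sum_nonneg fun u _ => (hμ _ u).le) (sum_nonneg fun u _ => (hμ _ u).le))
    (mul_nonneg (sum_nonneg fun u _ => (hμ _ u).le) (sum_nonneg fun u _ => (hμ _ u).le))) (hd ⟨0, hK⟩)
  have hnum : t * (1 / (2 * K) * ∑ j : Fin K, (((j.castSucc : ℕ) : ℝ) - ((j.succ : ℕ) : ℝ)) ^ 2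
          * ((∑ u ∈ A, μ j.castSucc u) * (∑ u ∈ Aᶜ, μ j.succ u)
            + (∑ u ∈ Aᶜ, μ j.castSucc u) * ∑ u ∈ A, μ j.succ u))
        + (1 - t) * (1 / (K + 1) * ∑ k : Fin (K + 1), ((k : ℕ) : ℝ) ^ 2 * edgeMeasure (μ k) (M k) A Aᶜ)
      ≤ t * (d / 2)
        + (1 - t) * (1 / (K + 1) * ∑ k : Fin (K + 1), ((k : ℕ) : ℝ) ^ 2 * edgeMeasure (μ k) (M k) A Aᶜ) := by
    have := mul_le_mul_of_nonneg_left hswap ht0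
    linarith
  have hnum0 : 0 ≤ t * (d / 2)
      + (1 - t) * (1 / (K + 1) * ∑ k : Fin (K + 1), ((k : ℕ) : ℝ) ^ 2 * edgeMeasure (μ k) (M k) A Aᶜ) :=
    add_nonneg (by positivity) hQ
  calc spectralGap (tensorFun μ) (ptBareSampler t μ M)
      ≤ _ := hmain
    _ ≤ (t * (d / 2)
          + (1 - t) * (1 / (K + 1) * ∑ k : Fin (K + 1), ((k : ℕ) : ℝ) ^ 2 * edgeMeasure (μ k) (M k) A Aᶜ))
        / ∑ k : Fin (K + 1), ((k : ℕ) : ℝ) ^ 2 * ((∑ u ∈ A, μ k u) * ∑ u ∈ Aᶜ, μ k u) :=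
        div_le_div_of_nonneg_right hnum hA.le
    _ ≤ (t * (d / 2)
          + (1 - t) * (1 / (K + 1) * ∑ k : Fin (K + 1), ((k : ℕ) : ℝ) ^ 2 * edgeMeasure (μ k) (M k) A Aᶜ))
        / (v * ((K : ℝ) * (K + 1) * (2 * K + 1) / 6)) :=
        div_le_div_of_nonneg_left hnum0 hS hnorm
    _ = 6 * (t * (d / 2) + (1 - t) * (1 / (K + 1) * ∑ k : Fin (K + 1), ((k : ℕ) : ℝ) ^ 2
          * edgeMeasure (μ k) (M k) A Aᶜ)) / (v * ((K : ℝ) * (K + 1) * (2 * K + 1))) := by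
        rw [div_eq_div_iff (by positivity) (by positivity)]
        ring

/-- **REPLICA EXCHANGE IS AT BEST DIFFUSIVE IN THE NUMBER OF REPLICAS:** if no replica at a level `k ≥ 1` crosses the
sector on its own (`Q_k(A,Aᶜ) = 0`, `k ≠ 0`; the hot update `M_0` arbitrary, even perfect), `D_j(A) ≤ d` and
`μ_k(A)μ_k(Aᶜ) ≥ v > 0` (`k ≥ 1`), then `Gap(ptBareSampler t μ M) ≤ 3·t·d/(v·K(K+1)(2K+1))`. [ours] -/
theorem ptBareFrozenSector_spectralGap_le [Nontrivial S] (hK : 1 ≤ K) (hμ : ∀ k x, 0 < μ k x)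
    (hμ1 : ∀ k, ∑ u, μ k u = 1) (hM : ∀ k, IsRowStochastic (M k)) (hMrev : ∀ k, DetailedBalance (μ k) (M k))
    (ht0 : 0 ≤ t) (ht1 : t ≤ 1) (A : Finset S) {d v : ℝ} (hvpos : 0 < v)
    (hd : ∀ j : Fin K, (∑ u ∈ A, μ j.castSucc u) * (∑ u ∈ Aᶜ, μ j.succ u)
      + (∑ u ∈ Aᶜ, μ j.castSucc u) * ∑ u ∈ A, μ j.succ u ≤ d)
    (hv : ∀ k : Fin (K + 1), k ≠ 0 → v ≤ (∑ u ∈ A, μ k u) * ∑ u ∈ Aᶜ, μ k u)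
    (hfrozen : ∀ k : Fin (K + 1), k ≠ 0 → edgeMeasure (μ k) (M k) A Aᶜ = 0) :
    spectralGap (tensorFun μ) (ptBareSampler t μ M) ≤ 3 * t * d / (v * ((K : ℝ) * (K + 1) * (2 * K + 1))) := by
  have h := ptBareLinear_spectralGap_le (t := t) (M := M) hK hμ hμ1 hM hMrev ht0 ht1 A hvpos hd hv
  have hQ0 : ∑ k : Fin (K + 1), ((k : ℕ) : ℝ) ^ 2 * edgeMeasure (μ k) (M k) A Aᶜ = 0 := by
    refine Finset.sum_eq_zero fun k _ => ?_
    by_cases hk : k = 0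
    · subst hk; simp
    · rw [hfrozen k hk, mul_zero]
  rw [hQ0, mul_zero, mul_zero, add_zero] at h
  calc spectralGap (tensorFun μ) (ptBareSampler t μ M) ≤ _ := h
    _ = 3 * t * d / (v * ((K : ℝ) * (K + 1) * (2 * K + 1))) := by ring

end Profile

end Summit.Ventures.LatticeQCDFlow.Scaling

end
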